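import Mathlib
import Summits.Ventures.PercRepro2.LocRows
import Summits.Ventures.PercRepro2.SwRow
import Summits.Ventures.PercRepro2.SwOut
import Summits.Ventures.PercRepro2.SwAllRow
import Summits.Ventures.PercRepro2.SwOutAll
import Summits.Ventures.PercRepro2.SwOutArmFlip
import Summits.Ventures.PercRepro2.SwOutArmThm
import Summits.Ventures.PercRepro2.SwOutCoreDefs
import Summits.Ventures.PercRepro2.SwOutCube
import Summits.Ventures.PercRepro2.SwOutMixedCubeFarDefs
import Summits.Ventures.PercRepro2.SwOutBigBlockDefs
import Summits.Ventures.PercRepro2.SwOutBigBlockCube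
import Summits.Ventures.PercRepro2.SwOutMixedBaseDefs
import Summits.Ventures.PercRepro2.SwOutMixedBaseClasses
import Summits.Ventures.PercRepro2.SwOutMixedBaseHull
import Summits.Ventures.PercRepro2.SwOutMixedBaseDual
import Summits.Ventures.PercRepro2.SwOutMixedBaseArm
import Summits.Ventures.PercRepro2.SwOutMixedCore
import Summits.Ventures.PercRepro2.SwOutMixedCorePieces
import Summits.Ventures.PercRepro2.SwOutMixedCoreLower
import Summits.Ventures.PercRepro2.SwOutMixedCoreThm
import Summits.Ventures.PercRepro2.SwOutMixedCoreTransfer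
import Summits.Ventures.PercRepro2.SwOutMixedCoreEdgeMap
import Summits.Ventures.PercRepro2.SwOutMixedCoreEdges
import Summits.Ventures.PercRepro2.SwOutMixedCoreMoveUP
import Summits.Ventures.PercRepro2.SwOutMixedCoreFlipGeneric
import Summits.Ventures.PercRepro2.SwOutMixedCoreBlockLower

/-!
# THE BLOCK THEOREM OF THE MIXED SINGLE JUNCTION (blind cell PercRepro2, night-4 g18, 2026-08-27;
proofs/NIGHT4-G18.md §6)

**Theorem** `rigid_block`: for a mixed base (u-arms `U j` joined to `u`, the h-piece `Ah` with its
dead edges to the single dropped vertex `p`, far arms `F k`, the base colouring `σ`), whose region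
`Us` contains `h`, `u`, `p` and the arms and not `l`, with `o ≠ u` and every edge class non-empty,
the BLOCK `C = mixedReal '' {¬ Leak'}` (the realisations of the non-leaking points of the raw cube)
satisfies the rigid counting inequality of (SW) on `C ∩ tgtU` for every up-set `𝓔` of edge sets:
`#{ζ ∈ C ∩ Q : redEdges ζ h ∈ 𝓔} ≤ #{ζ ∈ C ∩ Q : blueEdges ζ h ∈ 𝓔}`.

Proof: the transfer `card_le_of_mixedCore_edges` (the corrected abstract big-block lemma, three
cubes) with `r = mixedReal` — injective (`mixedReal_injective`: the classes are disjoint and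
non-empty), the block-lowerness of the pulled-back conditioning (`blockLower_tgtU`, the (G3)
moves), `G5` (`mem_tgtU_toggleX` p491111, the X-move), and the edge-set forms of the hull formulas
(`redEdges_mixedReal` / `blueEdges_mixedReal`) with the monotone edge map `φM`.
-/

namespace Summit.Ventures.PercRepro2

namespace BigBlock

open Hull LocRows

open scoped Classical

variable {V : Type*} {E : Type*}

section Inj

variable {ι κ : Type*} {ends : E → Sym2 V} {σ : Config E} {h u p : V} {U : ι → Set V} {Ah : Set V}
  {F : κ → Set V} (hb : MixedBase ends σ h u p U Ah F)
include hb

omit hb in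
/-- Two points with the same realisation agree on a class with an edge. -/
lemma coord_eq_of_mixedReal_eq {q q' : Pt ι κ}
    (hqq : mixedReal ends u p U Ah F σ q = mixedReal ends u p U Ah F σ q') {e : E} {b b' : Bool}
    (hq : mixedReal ends u p U Ah F σ q e = (if b = true then σ e else !σ e))
    (hq' : mixedReal ends u p U Ah F σ q' e = (if b' = true then σ e else !σ e)) : b = b' := by
  have := congrFun hqq e
  rw [hq, hq'] at this
  cases b <;> cases b' <;> simp_all

/-- **The realisation is injective** when every class has an edge. -/
theorem MixedBase.mixedReal_injective (hup : ∃ e, ends e = s(u, p))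
    (hAe : ∃ e, e ∈ touches ends Ah) (hFe : ∀ k, ∃ e, e ∈ touches ends (F k))
    (hext : ∃ e, e ∈ clsExt ends u p Ah) :
    Function.Injective (mixedReal ends u p U Ah F σ) := by
  intro q q' hqq
  obtain ⟨s, a, uP, e, f⟩ := q
  obtain ⟨s', a', uP', e', f'⟩ := q'
  simp only [Prod.mk.injEq]
  refine ⟨?_, ?_, ?_, ?_, ?_⟩
  · funext j
    obtain ⟨e₀, x, hex, hx⟩ := hb.u_adj_U j
    have ht : e₀ ∈ touches ends (U j) := ⟨x, hx, u, ends_swap hex⟩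
    exact coord_eq_of_mixedReal_eq hqq (hb.mixedReal_apply_U ht) (hb.mixedReal_apply_U ht)
  · obtain ⟨e₀, ht⟩ := hAe
    exact coord_eq_of_mixedReal_eq hqq (hb.mixedReal_apply_Ah ht) (hb.mixedReal_apply_Ah ht)
  · obtain ⟨e₀, hup'⟩ := hup
    exact coord_eq_of_mixedReal_eq hqq (hb.mixedReal_apply_UP hup') (hb.mixedReal_apply_UP hup')
  · obtain ⟨e₀, hx⟩ := hext
    exact coord_eq_of_mixedReal_eq hqq (hb.mixedReal_apply_Ext hx) (hb.mixedReal_apply_Ext hx)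
  · funext k
    obtain ⟨e₀, ht⟩ := hFe k
    exact coord_eq_of_mixedReal_eq hqq (hb.mixedReal_apply_F ht) (hb.mixedReal_apply_F ht)

end Inj

section Block

variable {ι κ : Type*} [Fintype ι] [DecidableEq ι] [Fintype κ] [DecidableEq κ]
  [Fintype E] [DecidableEq E]
  {ends : E → Sym2 V} {σ : Config E} {h u p : V} {U : ι → Set V} {Ah : Set V}
  {F : κ → Set V}

/-- The block: the realisations of the non-leaking points. -/
noncomputable def blockC (ends : E → Sym2 V) (σ : Config E) (u p : V) (U : ι → Set V) (Ah : Set V)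
    (F : κ → Set V) : Finset (Config E) :=
  (Finset.univ.filter fun q : Pt ι κ => ¬ Leak' q).image (mixedReal ends u p U Ah F σ)

variable (hb : MixedBase ends σ h u p U Ah F)
include hb

/-- **THE BLOCK THEOREM OF THE MIXED SINGLE JUNCTION**: the rigid counting inequality on the
block of a mixed base, for every up-set of edge sets. -/
theorem MixedBase.rigid_block [Nonempty ι] (hup : ∃ e, ends e = s(u, p))
    (hAe : ∃ e, e ∈ touches ends Ah) (hFe : ∀ k, ∃ e, e ∈ touches ends (F k))
    (hext : ∃ e, e ∈ clsExt ends u p Ah) {Us : Set V} {l o : V}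
    (hUs : {h} ∪ {u} ∪ {p} ∪ armsAll U Ah F ⊆ Us) (hl : l ∉ Us) (hou : o ≠ u)
    {𝓔 : Set (Set E)} (h𝓔 : IsUpperSet 𝓔) :
    ((blockC ends σ u p U Ah F).filter fun ζ =>
        ζ ∈ (tgtU ends l h {S : Set V | o ∈ S} : Set (Config E)) ∧ redEdges ends ζ h ∈ 𝓔).card ≤
      ((blockC ends σ u p U Ah F).filter fun ζ =>
        ζ ∈ (tgtU ends l h {S : Set V | o ∈ S} : Set (Config E)) ∧
          blueEdges ends ζ h ∈ 𝓔).card := by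
  have hinj := hb.mixedReal_injective hup hAe hFe hext
  have hC : ∀ ζ, ζ ∈ blockC ends σ u p U Ah F ↔ ∃ q, ¬ Leak' q ∧ mixedReal ends u p U Ah F σ q = ζ := by
    intro ζ
    simp only [blockC, Finset.mem_image, Finset.mem_filter, Finset.mem_univ, true_and]
  have hEv : ∀ q q' : Pt ι κ, ¬ Leak' q → ¬ Leak' q' → q' ≤ q →
      mixedReal ends u p U Ah F σ q ∈ (tgtU ends l h {S : Set V | o ∈ S} : Set (Config E)) →
      mixedReal ends u p U Ah F σ q' ∈ (tgtU ends l h {S : Set V | o ∈ S} : Set (Config E)) :=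
    fun q q' hq hq' hle hQ => hb.blockLower_tgtU hup hUs hl hou q q' hq hq' hle hQ
  have hG : G5 {q : Pt ι κ |
      mixedReal ends u p U Ah F σ q ∈ (tgtU ends l h {S : Set V | o ∈ S} : Set (Config E))} := by
    intro a e f hQ
    have hXU : coarseX u U ⊆ Us := by
      rintro x (hx | hx)
      · exact hUs (Or.inl (Or.inl (Or.inr hx)))
      · exact hUs (Or.inr (Or.inl (Or.inl hx)))
    have key := hb.mem_tgtU_toggleX hup hXU hl (q := ((fun _ => true), a, false, e, f))
      (fun _ => rfl) rfl hQ
    have : toggleX (((fun _ => true) : Config ι), a, false, e, f) =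
        ((fun _ => false), a, true, e, f) := by
      simp only [toggleX, Bool.not_false, Prod.mk.injEq, and_true]
      funext _
      rfl
    rw [this] at key
    exact key
  have hR : ∀ q : Pt ι κ, ¬ Leak' q →
      redEdges ends (mixedReal ends u p U Ah F σ q) h = φM ends σ h u p U Ah F (ER q) := by
    intro q hq
    rw [leak'_iff, not_or] at hq
    exact hb.redEdges_mixedReal hup hq.1
  have hB : ∀ q : Pt ι κ, ¬ Leak' q →
      blueEdges ends (mixedReal ends u p U Ah F σ q) h = φM ends σ h u p U Ah F (EB q) := by
    intro q hq
    rw [leak'_iff, not_or] at hq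
    exact hb.blueEdges_mixedReal hup hq.2
  have key := card_le_of_mixedCore_edges (ends := ends) (mixedReal ends u p U Ah F σ)
    (fun q q' _ _ hqq => hinj hqq) (blockC ends σ u p U Ah F) hC
    (tgtU ends l h {S : Set V | o ∈ S} : Set (Config E)) hEv hG h (φM ends σ h u p U Ah F)
    (φM_mono ends σ h u p U Ah F) hR hB h𝓔
  convert key using 2 <;> congr

end Block

end BigBlock

end Summit.Ventures.PercRepro2
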